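import Literature.AlgebraicGeometry.Motives.Correspondences
import Literature.AlgebraicGeometry.Motives.SegreEmbedding
import HarnessLib

/-!
# Discharged fact: transposes of algebraic correspondences are algebraic

`Literature.AlgebraicGeometry.Motives.Correspondences` records as a named fact (D-0014)
`Literature.AlgebraicGeometry.Motives.WeilCohomology.isAlgebraicGradedOp_transpose : Prop` — for a
Weil cohomology theory `W`, smooth projective `X`, `Y` of dimensions `nX`, `nY`, a graded operator
`T : H•(X) → H•(Y)` induced by algebraic correspondences with `ℚ`-coefficients and its transpose
`T'` (adjoint for the Poincaré duality pairings, `W.IsTransposeOp`), the operator `T'` is again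
induced by algebraic correspondences, namely by the transposed classes `σ* u`
(S. Kleiman, *Algebraic cycles and the Weil conjectures* (1968), §1.3; B. Kahn, *Zeta and
`L`-functions of varieties and motives* (2020), §3.5.3 and Lemma 3.48 "`ᵗφ = σ* φ`";
W. Fulton, *Intersection theory*, 16.1, `α' = τ_* α` and Prop. 16.1.2 (b) `(α')_* = α^*`).
This file **proves** it (`WeilCohomology.isAlgebraicGradedOp_transpose_holds`), together with the
tools on products that the companion file `CorrespondencesCompProofs` (composites of algebraic
correspondences) reuses.

## The argument (formal in the axioms of `WeilCohomology`)

* `kunneth_induction`: by the Künneth axiom (B) every class on `X × Y` is a sum of external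
  products `pr₁* a ∪ pr₂* b`, so additive statements about classes on `X × Y` reduce to external
  products; `externalCup_eq_zero_of_ne`: in top total degree `2(nX + nY)` an external product
  vanishes off the bidegree `(2nX, 2nY)` (axiom (A), `Hⁱ = 0` for `i > 2 dim`).
* `cup_cup_externalCup`: `(pr₁* x ∪ (pr₁* a ∪ pr₂* b)) ∪ pr₂* y = pr₁* (x ∪ a) ∪ pr₂* (b ∪ y)`
  (`cup_assoc`, `map_cup`), whence with `trace_externalCup` the value of Kleiman's pairing
  `tr_{X×Y} ((pr₁* x ∪ u) ∪ pr₂* y)` on an external product `u = pr₁* a ∪ pr₂* b`: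
  `tr_X (x ∪ a) · tr_Y (b ∪ y)` in the top bidegree and `0` otherwise
  (`trace_cup_cup_externalCup_of_eq`, `trace_cup_cup_externalCup_of_ne`); this is Kahn's
  formula (3.5.3), `(v ⊗ w)(x) = ⟨x, v⟩ w`.
* `transposeClass_externalCup`: `σ* (pr₁* a ∪ pr₂* b) = (-1)^{|a||b|} pr₁* b ∪ pr₂* a` on `Y × X`
  (`map_cup`, `pullback_comp` with `σ ≫ pr₁ = pr₂`, `σ ≫ pr₂ = pr₁`, `cup_comm`); Kahn (3.5.4).
* `isInducedBy_transposeClass_of_adjoint` (the transpose lemma for one operator): if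
  `T : Hⁱ(X) → Hʲ(Y)` is induced by `u ∈ H²ᶜ(X × Y)` and `T'` is adjoint to `T`, then `T'` is
  induced by `σ* u`. By Künneth induction on `u` both pairings are computed by the previous two
  items; the signs `(-1)^{i'i}` (adjunction) and `(-1)^{|a||b| + j'|b| + |a| i}` (transposition)
  agree because `i`, `i'`, `j'`, `|a|`, `|b|` all have the same parity when the correspondence
  has even degree `2c` (`negOnePow_mul_eq_of_parity`).
* `isAlgebraicGradedOp_transpose_holds`: componentwise the transpose lemma (`σ* u_c` is a rational
  algebraic class by the axiom `pullback_ratAlgebraicClasses_le` along the braiding), and the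
  components of `T'` in bidegrees not of the form `(j', j' + 2c - 2nY)` vanish because the
  corresponding components of `T` do and the Poincaré pairing is perfect
  (`isPerfPair_cupPairing`), or because source/target vanish above degree `2 dim`.

Products of smooth projective varieties are smooth projective by the discharged fact
`IsSmoothProjective.tensor_holds` (`SegreEmbedding`). No statement of `Correspondences.lean` is
restated or modified; the new declarations are lemmas about an arbitrary `W : WeilCohomology k K`.

## References

* S. Kleiman, *Algebraic cycles and the Weil conjectures*, in: Dix exposés sur la cohomologie des
  schémas, North-Holland (1968), §1.3. [Kleiman1968AlgebraicCycles]
* B. Kahn, *Zeta and L-functions of varieties and motives*, LMS Lecture Note Series 462, CUP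
  (2020), §3.5.1–3.5.3 (formulas (3.5.2)–(3.5.4), Lemma 3.48). [Kahn2020]
* W. Fulton, *Intersection theory*, Springer (1984/1998), §16.1 (Def. 16.1.1, Prop. 16.1.2).
  [Fulton1998]
-/

universe u v

open CategoryTheory AlgebraicGeometry MonoidalCategory CartesianMonoidalCategory Opposite
open scoped TensorProduct DirectSum

noncomputable section

namespace Literature.AlgebraicGeometry.Motives

namespace WeilCohomology

variable {k : Type u} [Field k] {K : Type v} [Field K] [CharZero K] (W : WeilCohomology k K)

/-! ## Signs -/

/-- Two products of natural numbers all of whose factors have one and the same parity have the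
same sign `(-1)^{ab} = (-1)^{cd}`. [folklore] -/
lemma negOnePow_mul_eq_of_parity {a b c d : ℕ} (hab : Even a ↔ Even b) (hbc : Even b ↔ Even c)
    (hcd : Even c ↔ Even d) :
    ((a : ℤ) * b).negOnePow = ((c : ℤ) * d).negOnePow := by
  rcases Nat.even_or_odd a with ha | ha
  · have hc : Even c := hbc.mp (hab.mp ha)
    rw [Int.negOnePow_even _ (Int.even_mul.mpr (Or.inl (by exact_mod_cast ha))),
      Int.negOnePow_even _ (Int.even_mul.mpr (Or.inl (by exact_mod_cast hc)))]
  · have hb : Odd b := Nat.not_even_iff_odd.mp fun h ↦ (Nat.not_even_iff_odd.mpr ha) (hab.mpr h)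
    have hc : Odd c := Nat.not_even_iff_odd.mp fun h ↦ (Nat.not_even_iff_odd.mpr hb) (hbc.mpr h)
    have hd : Odd d := Nat.not_even_iff_odd.mp fun h ↦ (Nat.not_even_iff_odd.mpr hc) (hcd.mpr h)
    rw [Int.negOnePow_odd _ (Int.odd_mul.mpr ⟨by exact_mod_cast ha, by exact_mod_cast hb⟩),
      Int.negOnePow_odd _ (Int.odd_mul.mpr ⟨by exact_mod_cast hc, by exact_mod_cast hd⟩)]

/-- `(-1)^{ab} = 1` if `a` or `b` is even. [folklore] -/
lemma negOnePow_mul_eq_one {a b : ℕ} (h : Even a ∨ Even b) : ((a : ℤ) * b).negOnePow = 1 :=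
  Int.negOnePow_even _ (Int.even_mul.mpr (h.imp (fun h ↦ by exact_mod_cast h)
    (fun h ↦ by exact_mod_cast h)))

section CupAlgebra

variable {n : ℕ} {X : SchemeOver k}

/-- Graded commutativity without sign when one of the degrees is even (`cup_comm` with
`(-1)^{ij} = 1`). [folklore] -/
lemma cup_comm_of_even (hX : IsSmoothProjective n X) {i j m : ℕ} (h : i + j = m) (h' : j + i = m)
    (he : Even i ∨ Even j) (a : W.obj X i) (b : W.obj X j) :
    W.cup h a b = W.cup h' b a := by
  rw [W.cup_comm hX h h' a b, negOnePow_mul_eq_one he, Units.val_one, one_smul]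

/-- Graded commutativity under the trace: `tr (a ∪ b) = (-1)^{ij} tr (b ∪ a)`. [folklore] -/
lemma trace_cup_comm (hX : IsSmoothProjective n X) {i j : ℕ} (h : i + j = 2 * n)
    (h' : j + i = 2 * n) (a : W.obj X i) (b : W.obj X j) :
    W.trace X n (W.cup h a b) = (((i : ℤ) * j).negOnePow : ℤ) • W.trace X n (W.cup h' b a) := by
  rw [W.cup_comm hX h h' a b, map_zsmul]

end CupAlgebra

/-! ## Künneth induction and external products -/

section Kunneth

variable {n m : ℕ} {X Y : SchemeOver k}

/-- `externalCup` unfolded: `a ⊠ b = pr₁* a ∪ pr₂* b`. [folklore] -/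
lemma externalCup_apply {i j d : ℕ} (h : i + j = d) (a : W.obj X i) (b : W.obj Y j) :
    W.externalCup X Y h a b = W.cup h (W.pullback (fst X Y) i a) (W.pullback (snd X Y) j b) :=
  rfl

/-- The Künneth map on an elementary tensor placed in bidegree `ij` is the external product. [folklore] -/
lemma kunnethMap_of_tmul {d : ℕ} (ij : ↥(Finset.antidiagonal d)) (a : W.obj X ij.1.1)
    (b : W.obj Y ij.1.2) :
    W.kunnethMap X Y d (DirectSum.of (fun ij : ↥(Finset.antidiagonal d) ↦
        W.obj X ij.1.1 ⊗[K] W.obj Y ij.1.2) ij (a ⊗ₜ b)) =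
      W.externalCup X Y (Finset.mem_antidiagonal.mp ij.2) a b := by
  rw [PreWeilCohomology.kunnethMap, ← DirectSum.lof_eq_of K, DirectSum.toModule_lof,
    TensorProduct.lift.tmul]

/-- **Künneth induction** (axiom (B)): an additive property of classes on `X × Y` (both smooth
projective) holds everywhere as soon as it holds for external products `pr₁* a ∪ pr₂* b`. [folklore] -/
theorem kunneth_induction (hX : IsSmoothProjective n X) (hY : IsSmoothProjective m Y) {d : ℕ}
    {P : W.obj (X ⊗ Y) d → Prop} (zero : P 0) (add : ∀ w w', P w → P w' → P (w + w'))
    (ext : ∀ (i j : ℕ) (h : i + j = d) (a : W.obj X i) (b : W.obj Y j),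
      P (W.externalCup X Y h a b))
    (w : W.obj (X ⊗ Y) d) : P w := by
  obtain ⟨t, rfl⟩ := (W.bijective_kunnethMap hX hY d).2 w
  induction t using DirectSum.induction_on with
  | zero => simpa only [map_zero] using zero
  | of ij x =>
    induction x using TensorProduct.induction_on with
    | zero => simpa only [map_zero] using zero
    | tmul a b =>
      rw [kunnethMap_of_tmul]
      exact ext _ _ _ a b
    | add x y hx hy => simpa only [map_add] using add _ _ hx hy
  | add x y hx hy => simpa only [map_add] using add _ _ hx hy

/-- In top total degree `2(n + m)` an external product `pr₁* a ∪ pr₂* b` on `X × Y` vanishes unless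
`a` has degree `2n` (and `b` degree `2m`): otherwise one factor lives above twice the dimension
(axiom (A)). [folklore] -/
lemma externalCup_eq_zero_of_ne (hX : IsSmoothProjective n X) (hY : IsSmoothProjective m Y)
    {i j : ℕ} (h : i + j = 2 * (n + m)) (hi : i ≠ 2 * n) (a : W.obj X i) (b : W.obj Y j) :
    W.externalCup X Y h a b = 0 := by
  rcases Nat.lt_or_gt_of_ne hi with hi | hi
  · haveI := W.subsingleton_obj hY (i := j) (by omega)
    rw [Subsingleton.elim b 0, map_zero]
  · haveI := W.subsingleton_obj hX (i := i) (by omega)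
    rw [Subsingleton.elim a 0, LinearMap.map_zero₂]

/-- The trace is multiplicative on external products of top-degree classes (axiom (B),
`trace_externalCup`, with an arbitrary proof of the degree identity). [folklore] -/
lemma trace_externalCup' (hX : IsSmoothProjective n X) (hY : IsSmoothProjective m Y)
    (h : 2 * n + 2 * m = 2 * (n + m)) (a : W.obj X (2 * n)) (b : W.obj Y (2 * m)) :
    W.trace (X ⊗ Y) (n + m) (W.externalCup X Y h a b) = W.trace X n a * W.trace Y m b :=
  W.trace_externalCup hX hY a b

/-- Reassociation on `X × Y`: `(pr₁* x ∪ (pr₁* a ∪ pr₂* b)) ∪ pr₂* y = pr₁* (x ∪ a) ∪ pr₂* (b ∪ y)`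
(`cup_assoc`, `map_cup`). The degrees are `|x| = i`, `|a| = s`, `|b| = t`, `|y| = j'` with
`s + t = d`, `i + d + j' = N`, `i + s = e₁`, `t + j' = e₂`, `e₁ + e₂ = N`. [folklore] -/
lemma cup_cup_externalCup (hX : IsSmoothProjective n X) (hY : IsSmoothProjective m Y)
    {i s t d j' e₁ e₂ N : ℕ} (hst : s + t = d) (hm : i + d + j' = N) (h₁ : i + s = e₁)
    (h₂ : t + j' = e₂) (h' : e₁ + e₂ = N) (x : W.obj X i) (a : W.obj X s) (b : W.obj Y t)
    (y : W.obj Y j') :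
    W.cup hm (W.cup rfl (W.pullback (fst X Y) i x) (W.externalCup X Y hst a b))
        (W.pullback (snd X Y) j' y) =
      W.externalCup X Y h' (W.cup h₁ x a) (W.cup h₂ b y) := by
  have hXY := IsSmoothProjective.tensor_holds hX hY
  have h₃ : e₁ + t = i + d := by omega
  rw [externalCup_apply, externalCup_apply, ← W.cup_assoc hXY h₁ hst h₃ rfl,
    ← W.map_cup hXY hX (fst X Y) h₁, W.cup_assoc hXY h₃ h₂ hm h', ← W.map_cup hXY hY (snd X Y) h₂]

/-- Kleiman's pairing `tr_{X×Y} ((pr₁* x ∪ u) ∪ pr₂* y)` on an external product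
`u = pr₁* a ∪ pr₂* b` in the top bidegree `|x| + |a| = 2n` (so `|b| + |y| = 2m`):
`tr_X (x ∪ a) · tr_Y (b ∪ y)` (Kahn 2020, (3.5.3): `(v ⊗ w)(x) = ⟨x, v⟩ w`). [cite: Kahn2020, §3.5.2 formula (3.5.3)] -/
lemma trace_cup_cup_externalCup_of_eq (hX : IsSmoothProjective n X) (hY : IsSmoothProjective m Y)
    {i s t d j' : ℕ} (hst : s + t = d) (hm : i + d + j' = 2 * (n + m)) (h₁ : i + s = 2 * n)
    (h₂ : t + j' = 2 * m) (x : W.obj X i) (a : W.obj X s) (b : W.obj Y t) (y : W.obj Y j') :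
    W.trace (X ⊗ Y) (n + m) (W.cup hm (W.cup rfl (W.pullback (fst X Y) i x)
        (W.externalCup X Y hst a b)) (W.pullback (snd X Y) j' y)) =
      W.trace X n (W.cup h₁ x a) * W.trace Y m (W.cup h₂ b y) := by
  rw [W.cup_cup_externalCup hX hY hst hm h₁ h₂ (by omega), W.trace_externalCup' hX hY]

/-- Kleiman's pairing `tr_{X×Y} ((pr₁* x ∪ u) ∪ pr₂* y)` on an external product
`u = pr₁* a ∪ pr₂* b` vanishes off the top bidegree, `|x| + |a| ≠ 2n`. [folklore] -/
lemma trace_cup_cup_externalCup_of_ne (hX : IsSmoothProjective n X) (hY : IsSmoothProjective m Y)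
    {i s t d j' : ℕ} (hst : s + t = d) (hm : i + d + j' = 2 * (n + m)) (h₁ : i + s ≠ 2 * n)
    (x : W.obj X i) (a : W.obj X s) (b : W.obj Y t) (y : W.obj Y j') :
    W.trace (X ⊗ Y) (n + m) (W.cup hm (W.cup rfl (W.pullback (fst X Y) i x)
        (W.externalCup X Y hst a b)) (W.pullback (snd X Y) j' y)) = 0 := by
  rw [W.cup_cup_externalCup hX hY hst hm rfl rfl (by omega),
    W.externalCup_eq_zero_of_ne hX hY _ h₁, map_zero]

/-- **Transpose of an external product** (Kahn 2020, (3.5.4), Koszul sign rule): on `Y × X`,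
`σ* (pr₁* a ∪ pr₂* b) = (-1)^{|a||b|} pr₁* b ∪ pr₂* a`, where `σ : Y × X ≅ X × Y` is the braiding
(`W.transposeClass`). [cite: Kahn2020, §3.5.3 formula (3.5.4)] -/
lemma transposeClass_externalCup (hX : IsSmoothProjective n X) (hY : IsSmoothProjective m Y)
    {s t d : ℕ} (hst : s + t = d) (hts : t + s = d) (a : W.obj X s) (b : W.obj Y t) :
    W.transposeClass (W.externalCup X Y hst a b) =
      (((s : ℤ) * t).negOnePow : ℤ) • W.externalCup Y X hts b a := by
  have hXY := IsSmoothProjective.tensor_holds hX hY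
  have hYX := IsSmoothProjective.tensor_holds hY hX
  simp only [PreWeilCohomology.transposeClass, externalCup_apply]
  rw [W.map_cup hYX hXY (β_ Y X).hom hst, ← LinearMap.comp_apply (W.pullback (β_ Y X).hom s),
    ← W.pullback_comp, braiding_hom_fst, ← LinearMap.comp_apply (W.pullback (β_ Y X).hom t),
    ← W.pullback_comp, braiding_hom_snd, W.cup_comm hYX hst hts]

end Kunneth

/-! ## The transpose of an induced operator -/

section Transpose

variable {nX nY : ℕ} {X Y : SchemeOver k}

/-- **Transpose lemma** (Kleiman 1968 §1.3, `⟨u x, y⟩ = ⟨x, ᵗu y⟩` with `ᵗu = σ* u`; Kahn 2020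
Lemma 3.48; Fulton 16.1.2 (b) `(α')_* = α^*`): if `T : Hⁱ(X) → Hʲ(Y)` is induced by a
correspondence `u ∈ H²ᶜ(X × Y)` of even degree and `T' : Hʲ'(Y) → Hⁱ'(X)` is adjoint to `T`
for the Poincaré duality pairings (`tr_Y (T x ∪ y) = tr_X (x ∪ T' y)`), then `T'` is induced by
the transposed class `σ* u ∈ H²ᶜ(Y × X)` (no sign: `i ≡ j' (mod 2)` as `i + 2c + j' = 2(nX + nY)`).

Depends only on: `IsSmoothProjective.tensor_holds`, `bijective_kunnethMap` (Künneth induction on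
`u`), `cup_assoc`, `cup_comm`, `map_cup`, `pullback_comp`, `trace_externalCup`,
`subsingleton_obj`. [cite: Kahn2020, §3.5.3 Lemma 3.48] -/
theorem isInducedBy_transposeClass_of_adjoint (hX : IsSmoothProjective nX X)
    (hY : IsSmoothProjective nY Y) {c i j j' i' : ℕ} {u : W.obj (X ⊗ Y) (2 * c)}
    {T : W.obj X i →ₗ[K] W.obj Y j} {hj : j + j' = 2 * nY} {hm : i + 2 * c + j' = 2 * (nX + nY)}
    (hT : W.IsInducedBy nX nY u T hj hm) {T' : W.obj Y j' →ₗ[K] W.obj X i'}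
    (hi : i + i' = 2 * nX)
    (hadj : ∀ (x : W.obj X i) (y : W.obj Y j'),
      W.cupPairing Y nY j j' hj (T x) y = W.cupPairing X nX i i' hi x (T' y))
    (hi' : i' + i = 2 * nX) (hm' : j' + 2 * c + i = 2 * (nY + nX)) :
    W.IsInducedBy nY nX (W.transposeClass u) T' hi' hm' := by
  intro y x
  have h1 : W.trace X nX (W.cup hi' (T' y) x) =
      (((i' : ℤ) * i).negOnePow : ℤ) • W.trace (X ⊗ Y) (nX + nY)
        (W.cup hm (W.cup rfl (W.pullback (fst X Y) i x) u) (W.pullback (snd X Y) j' y)) := by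
    rw [W.trace_cup_comm hX hi' hi (T' y) x]
    congr 1
    exact ((hadj x y).symm).trans (hT x y)
  rw [h1]
  clear h1 hadj hT
  induction u using W.kunneth_induction hX hY with
  | zero => simp [PreWeilCohomology.transposeClass]
  | add w w' hw hw' =>
    simp only [PreWeilCohomology.transposeClass, map_add, LinearMap.add_apply, smul_add] at hw hw' ⊢
    rw [hw, hw']
  | ext s t hst a b =>
    have hts : t + s = 2 * c := by omega
    rw [W.transposeClass_externalCup hX hY hst hts a b, LinearMap.map_smul_of_tower,
      LinearMap.map_smul_of_tower, LinearMap.smul_apply, map_zsmul]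
    by_cases hA : i + s = 2 * nX
    · have hB : t + j' = 2 * nY := by omega
      have hA' : s + i = 2 * nX := by omega
      have hB' : j' + t = 2 * nY := by omega
      rw [W.trace_cup_cup_externalCup_of_eq hX hY hst hm hA hB,
        W.trace_cup_cup_externalCup_of_eq hY hX hts hm' hB' hA',
        W.trace_cup_comm hY hB' hB y b, W.trace_cup_comm hX hA' hA a x]
      have par : ∀ {p q r : ℕ}, p + q = 2 * r → (Even p ↔ Even q) := fun {p q r} h ↦
        ⟨fun ⟨w, hw⟩ ↦ ⟨r - w, by omega⟩, fun ⟨w, hw⟩ ↦ ⟨r - w, by omega⟩⟩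
      have hsign : (((s : ℤ) * t).negOnePow : ℤ) * (((j' : ℤ) * t).negOnePow : ℤ) *
          (((s : ℤ) * i).negOnePow : ℤ) = (((i' : ℤ) * i).negOnePow : ℤ) := by
        have e₁ : ((s : ℤ) * t).negOnePow = ((i' : ℤ) * i).negOnePow :=
          negOnePow_mul_eq_of_parity (par hst) (par (show t + i' = 2 * c by omega)) (par hi')
        have e₂ : ((j' : ℤ) * t).negOnePow = ((i' : ℤ) * i).negOnePow :=
          negOnePow_mul_eq_of_parity (par hB') (par (show t + i' = 2 * c by omega)) (par hi')
        have e₃ : ((s : ℤ) * i).negOnePow = ((i' : ℤ) * i).negOnePow :=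
          negOnePow_mul_eq_of_parity (par hA') (par hi) (par hi')
        rw [e₁, e₂, e₃, ← Units.val_mul, ← Units.val_mul, Int.units_mul_self, one_mul]
      simp only [zsmul_eq_mul]
      rw [← hsign]
      push_cast
      ring
    · have hB : j' + t ≠ 2 * nY := by omega
      rw [W.trace_cup_cup_externalCup_of_ne hX hY hst hm hA,
        W.trace_cup_cup_externalCup_of_ne hY hX hts hm' hB, smul_zero, smul_zero]

/-- **Transposes of algebraic correspondences are algebraic**: discharge of the named fact
`isAlgebraicGradedOp_transpose` (Kleiman 1968 §1.3, `ᵗu = σ* u` and `⟨u x, y⟩ = ± ⟨x, ᵗu y⟩`;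
Kahn 2020 Lemma 3.48; Fulton 16.1 and Prop. 16.1.2 (b)). If `T : H•(X) → H•(Y)` is induced by
the rational algebraic classes `u_c ∈ A^c(X × Y)_ℚ` and `T'` is its transpose
(`W.IsTransposeOp`), then `T'` is induced by the rational algebraic classes `σ* u_c ∈ A^c(Y × X)_ℚ`
(`pullback_ratAlgebraicClasses_le` along the braiding, `isInducedBy_transposeClass_of_adjoint`),
and its components in the remaining bidegrees vanish, because those of `T` do and the Poincaré
pairing is perfect (`isPerfPair_cupPairing`), or because `Hⁱ = 0` above twice the dimension.
[cite: Kleiman1968AlgebraicCycles, §1.3] [cite: Kahn2020, §3.5.3 Lemma 3.48] -/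
theorem isAlgebraicGradedOp_transpose_holds :
    isAlgebraicGradedOp_transpose (W := W) (nX := nX) (nY := nY) (X := X) (Y := Y) := by
  intro hX hY T T' hT hT'
  obtain ⟨u, hu, hu0⟩ := hT
  have hXY := IsSmoothProjective.tensor_holds hX hY
  have hYX := IsSmoothProjective.tensor_holds hY hX
  refine ⟨fun c ↦ ⟨W.transposeClass (u c : W.obj (X ⊗ Y) (2 * c)), ?_⟩, ?_, ?_⟩
  · exact W.pullback_ratAlgebraicClasses_le hYX hXY (β_ Y X).hom c ⟨u c, (u c).2, rfl⟩
  · intro j' i' c i hi' hm' hc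
    by_cases hj' : j' ≤ 2 * nY
    · obtain ⟨j, hj⟩ : ∃ j, j + j' = 2 * nY := ⟨2 * nY - j', by omega⟩
      have hm : i + 2 * c + j' = 2 * (nX + nY) := by omega
      have hi : i + i' = 2 * nX := by omega
      exact W.isInducedBy_transposeClass_of_adjoint hX hY (hu i j c j' hj hm (by omega)) hi
        (fun x y ↦ hT' i i' j j' hi hj x y) hi' hm'
    · intro y x
      haveI := W.subsingleton_obj hY (i := j') (by omega)
      rw [Subsingleton.elim y 0]
      simp
  · intro j' i' hne
    by_cases hi'2 : 2 * nX < i'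
    · haveI := W.subsingleton_obj hX hi'2
      ext y
      exact Subsingleton.elim _ _
    by_cases hj'2 : 2 * nY < j'
    · haveI := W.subsingleton_obj hY hj'2
      ext y
      rw [Subsingleton.elim y 0, map_zero, LinearMap.zero_apply]
    obtain ⟨i, hi⟩ : ∃ i, i + i' = 2 * nX := ⟨2 * nX - i', by omega⟩
    obtain ⟨j, hj⟩ : ∃ j, j + j' = 2 * nY := ⟨2 * nY - j', by omega⟩
    have hT0 : T i j = 0 := hu0 i j fun ⟨c, hc⟩ ↦ hne ⟨c, by omega⟩
    haveI := W.isPerfPair_cupPairing hX i i' hi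
    ext y
    refine (LinearMap.IsPerfPair.bijective_right (W.cupPairing X nX i i' hi)).1 ?_
    rw [LinearMap.zero_apply, map_zero]
    ext x
    rw [LinearMap.flip_apply, LinearMap.zero_apply, ← hT' i i' j j' hi hj x y, hT0,
      LinearMap.zero_apply, LinearMap.map_zero₂]

end Transpose

end WeilCohomology

end Literature.AlgebraicGeometry.Motives

end
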